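import Literature.NumberTheory.EllipticCurves.HeathBrown1994.CongruentTwoSelmerOddGraphFamilies
import HarnessLib

/-!
# Feng–Xiong's odd-graph criteria through Monsky's matrix: `s(n) = 0` for `n ≡ 3 (mod 8)` with one prime
# `≡ 3 (mod 4)`, and for `n = 2m` with all primes `≡ 1 (mod 4)` (§9b)

Topic `NumberTheory/EllipticCurves`, namespace `Literature.NumberTheory.EllipticCurves.HeathBrown1994.Families`
(continuation module of `HeathBrown1994/CongruentTwoSelmerMonskyMatrix.lean`, after §8
`CongruentTwoSelmerOddGraphFamilies.lean`).  Everything here is PROVED; no definition, no named fact.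
HONEST FRAMING (cell `b2b-bsdres`, sub-lane `bsd-p2`, Monsky sub-cell): kernel theorems about Monsky's printed
matrix; with §6 of the main file they give `BSD(E_n, ℓ)` for every prime `ℓ` on two further infinite
`s(n) = 0` families MODULO the four named facts displayed there (Monsky; Burungale–Tian 2026; Deuring–Hecke;
Burungale–Flach 2024). Census reach is EVIDENCE (p2-monsky-x / -eng K3 shadow: 34 391 + 5 051 new rows
`< 3·10⁶`, falsifier 0); nothing booked; no mark moved.

THE PRINTED THEOREMS (Feng–Xiong, J. Number Theory 2004, Thms. 2.4 and 2.6, in the verbatim restatement of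
Rhoades, J. Number Theory 129 (2009), §2 = arXiv:0706.4344 chunk p0006, read on the held text):

* (graphs, p0006 L12–L36) for odd square-free `n = p₁⋯p_t > 0`: `V(G(n)) = {p₁, …, p_t}`,
  `E(G(n)) = {p_i → p_j : (p_i/p_j) = −1}`; `V(G′(n)) = {2, p₁, …, p_t}`,
  `E(G′(n)) = {p_i → p_j : (p_i/p_j) = −1, p_i ≢ 3 (mod 4)} ∪ {r → 2 : r ≡ ±5 (mod 8)}` (i.e. `(2/r) = −1`);
  Def. 2.1/2.2 (L41–L56): a partition `(S, T)` is EVEN iff every vertex has an even number of arcs into the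
  other class; `G` is ODD iff its only even partitions are the trivial ones; Lemma 2.6 (= Feng–Xiong
  Lemma 2.2, L143–L147): "the number of even partitions of `G` is `2^{k−r}`, `r = rank_{𝔽₂} L(G)`,
  `L(G) = diag(d₁, …, d_k) + A(G)`. In particular, `G` is an odd graph if and only if `r = k − 1`."
* **Theorem 2.3 (Theorem 2.4 of [fx])** (L61–L71): "Suppose that `n ≡ ±3 (mod 8)`. Then `S^{(φ)}(E_n) = {1}`
  and `S^{(φ̂)}(E_n) = {±1, ±n}` if and only if the following three conditions are satisfied: `n ≡ 3 (mod 8)`;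
  `n = p₁⋯p_t`, `p₁ ≡ 3 (mod 4)` and `p_j ≡ 1 (mod 4)` for `2 ≤ j ≤ t`; `G(n)` is an odd graph."
* **Theorem 2.4 (Theorem 2.6 of [fx])** (L73–L78): "Suppose that `2 ∥ n` then `S^{(φ)}(E_n) = {1}` and
  `S^{(φ̂)}(E_n) = {±1, ±n}` if and only if `G′(n/2)` is odd. Furthermore, if `S^{(φ)}(E_n) = {1}` and
  `S^{(φ̂)}(E_n) = {±1, ±n}` then all odd primes dividing `n` are `1` modulo `4` and there is at least one
  that is `5` modulo `8`."

(Trivial `φ`- and `φ̂`-Selmer groups give `Sel₂(E_n) = E_n[2]`, i.e. Monsky's `s(n) = 0`; the printed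
theorems are NOT vendored — what is proved below is the matrix statement `det M = 1`, directly.)

WHAT IS PROVED (ours; linear algebra with Monsky's printed matrix, for EVERY number of prime factors):

* `det_monskyMatrixOdd_eq_one_of_oddGraph_three_mod_four` — `n = p₀p₁⋯p_k`, `p₀ ≡ 3 (mod 4)`,
  `pᵢ ≡ 1 (mod 4)` (`i ≥ 1`), `n ≡ 3 (mod 8)`, `G(n)` odd (kernel of `A` = `{0, 1}`) ⟹ `det M = 1`.
  Mechanism: `A` is symmetric (reciprocity) with zero row and column sums, `D₋₂ = D₂ + E₀₀`
  (`(−2/p) = (−1/p)(2/p)`), and `Σᵢ (D₂)ᵢᵢ = [(2/n) = −1] = 1` for `n ≡ 3 (mod 8)`; summing the coordinates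
  of `M(x, y) = 0` gives `y₀ = 0`, adding the two block rows gives `A(x + y) = 0`, so `x + y ∈ {0, 1}`:
  `y = x` forces `Ax = 0`, `x ∈ {0, 1}`, `x₀ = y₀ = 0`, `x = 0`; `y = x + 1` forces `Ax = D₂·1`, impossible
  since the coordinates of `Ax` sum to `0` and those of `D₂·1` to `1`.  This contains §8's case (I)
  (`p₀ ≡ 3 (mod 8)`, `pᵢ ≡ 1 (mod 8)`).
* `det_monskyMatrixEven_eq_one_of_oddGraph_two` — `n = 2p₀⋯p_{k}` with ALL `pᵢ ≡ 1 (mod 4)` and `G′(n/2)`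
  odd, in the kernel form `ker(A + D₂) = 0` ⟹ `det M = 1`.  Mechanism: `D₋₁ = 0` and `Aᵀ = A` make
  Monsky's even matrix block-triangular, `M = (A + D₂, 0; D₂, A + D₂)`.  READING OF `G′` ADOPTED (lead
  ML-23): the qualifier "`p_i ≢ 3 (mod 4)`" governs every arc, so under "all `pᵢ ≡ 1 (mod 4)`" the vertex `2`
  receives an arc exactly from the primes `≡ 5 (mod 8)` (`(2/r) = −1`) and has no out-arcs; then the even
  partitions of `G′(m)` are `(x₂; x)` with `(A + D₂)x = x₂ · D₂1`, i.e. `2 · #ker(A + D₂)` of them, and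
  "`G′(m)` odd" ⟺ `ker(A + D₂) = 0`.  (The per-`r` reading without the `1 (mod 4)` proviso is refuted by
  `n = 6`: `2w² = t⁴ − 9z⁴` has the solution `(t, z, w) = (3, 1, 6)`, so `S^{(φ̂)}(E_6) ∋ 2` — p2-monsky-x.)
  This contains §8's case (II) (`p₀ ≡ 5 (mod 8)`, `pᵢ ≡ 1 (mod 8)`, `G(n/2)` odd).
* `forall_bsdp_of_oddGraph_three_mod_four` / `forall_bsdp_of_oddGraph_two` — `BSD(E_n, ℓ)` for every prime
  `ℓ` on both families, modulo the four named facts of §6.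

## References

* [Rhoades2009] R. C. Rhoades, *2-Selmer groups and the Birch–Swinnerton-Dyer Conjecture for the congruent
  number curves*, J. Number Theory 129 (2009) 1379–1391 = arXiv:0706.4344: §2, graphs (chunk p0006 L12–L56),
  Thm. 2.3 (L61–L71), Thm. 2.4 (L73–L78), Lemma 2.6 (L143–L147) — restating K. Feng, M. Xiong, *On elliptic
  curves `y² = x³ − n²x` with rank zero*, J. Number Theory 109 (2004) 1–26, Thms. 2.4, 2.6, Lemma 2.2.
* [Feng1996NonCongruent] K. Feng, Acta Arith. 75 (1996): Lemma 2.2 (odd graphs and the rank of `M(G)`).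
* [HeathBrown1994SelmerCongruentII] D. R. Heath-Brown (appendix by P. Monsky), Invent. Math. 118 (1994),
  Appendix pp. 39–41 (the matrices `M`).
* [IrelandRosen1990] K. Ireland, M. Rosen, GTM 84, Ch. 5 §§1–2 (Legendre/Jacobi symbols, reciprocity,
  `(2/p)`, `(−1/p)`).
-/

open Matrix Finset Literature.NumberTheory.EllipticCurves Literature.NumberTheory.EllipticCurves.HeathBrown1994

namespace Literature.NumberTheory.EllipticCurves.HeathBrown1994.Families

variable {k : ℕ}

/-! ### §1. Symbols: `(2/·)` is additive on products, `(−2/p) = (−1/p)(2/p)` -/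

/-- The additive symbol of `(2/b)` for odd `b`: `1` iff `b ≡ ±3 (mod 8)`. [cite: IrelandRosen1990, Ch. 5 §1 Prop. 5.1.3 and §2 Prop. 5.2.2 ((2/b) for the Jacobi symbol)] -/
theorem addLegendreSym_two_eq {b : ℕ} (hb : Odd b) :
    addLegendreSym 2 b = if b % 8 = 3 ∨ b % 8 = 5 then 1 else 0 := by
  have hb8 : b % 8 = 1 ∨ b % 8 = 3 ∨ b % 8 = 5 ∨ b % 8 = 7 := by rcases hb with ⟨m, rfl⟩; omega
  rcases hb8 with h | h | h | h
  · rw [if_neg (by omega)]; exact addLegendreSym_of_eq_one (jacobiSym_two_eq_one (Or.inl h))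
  · rw [if_pos (Or.inl h)]; exact addLegendreSym_of_eq_neg_one (jacobiSym_two_eq_neg_one (Or.inl h))
  · rw [if_pos (Or.inr h)]; exact addLegendreSym_of_eq_neg_one (jacobiSym_two_eq_neg_one (Or.inr h))
  · rw [if_neg (by omega)]; exact addLegendreSym_of_eq_one (jacobiSym_two_eq_one (Or.inr h))

/-- The bit `[m ≡ ±3 (mod 8)]` is additive on products of odd numbers (multiplicativity of `(2/·)`).
[folklore] -/
private theorem ite_mod_eight_mul (a b : ℕ) (ha : a % 2 = 1) (hb : b % 2 = 1) :
    (if (a * b) % 8 = 3 ∨ (a * b) % 8 = 5 then (1 : ZMod 2) else 0) =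
      (if a % 8 = 3 ∨ a % 8 = 5 then (1 : ZMod 2) else 0) + (if b % 8 = 3 ∨ b % 8 = 5 then (1 : ZMod 2) else 0) := by
  have ha8 : a % 8 = 1 ∨ a % 8 = 3 ∨ a % 8 = 5 ∨ a % 8 = 7 := by omega
  have hb8 : b % 8 = 1 ∨ b % 8 = 3 ∨ b % 8 = 5 ∨ b % 8 = 7 := by omega
  have hab : (a * b) % 8 = ((a % 8) * (b % 8)) % 8 := Nat.mul_mod a b 8
  rw [hab]
  rcases ha8 with h1 | h1 | h1 | h1 <;> rcases hb8 with h2 | h2 | h2 | h2 <;> simp only [h1, h2] <;> decide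

/-- A product of odd numbers is odd. [folklore] -/
private theorem prod_mod_two_eq_one {ι : Type*} (s : Finset ι) (f : ι → ℕ) (hodd : ∀ i ∈ s, f i % 2 = 1) :
    (∏ i ∈ s, f i) % 2 = 1 := by
  classical
  induction s using Finset.induction_on with
  | empty => simp
  | insert a s ha ih =>
    rw [Finset.prod_insert ha, Nat.mul_mod, hodd a (Finset.mem_insert_self a s),
      ih fun i hi => hodd i (Finset.mem_insert_of_mem hi)]

/-- **`(2/·)` is additive on products of odd numbers** (multiplicativity of the Jacobi symbol in the lower
entry), here in the form: `Σᵢ [(2/pᵢ) = −1] = [(2/∏pᵢ) = −1]` over `𝔽₂`. [cite: IrelandRosen1990, Ch. 5 §2 Prop. 5.2.2 (properties of the Jacobi symbol)] -/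
theorem sum_addLegendreSym_two_eq {ι : Type*} (s : Finset ι) (f : ι → ℕ) (hodd : ∀ i ∈ s, f i % 2 = 1) :
    ∑ i ∈ s, addLegendreSym 2 (f i) =
      if (∏ i ∈ s, f i) % 8 = 3 ∨ (∏ i ∈ s, f i) % 8 = 5 then (1 : ZMod 2) else 0 := by
  classical
  induction s using Finset.induction_on with
  | empty => simp
  | insert a s ha ih =>
    have hodd' : ∀ i ∈ s, f i % 2 = 1 := fun i hi => hodd i (Finset.mem_insert_of_mem hi)
    have hfa : f a % 2 = 1 := hodd a (Finset.mem_insert_self a s)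
    rw [Finset.sum_insert ha, Finset.prod_insert ha, ih hodd', addLegendreSym_two_eq (Nat.odd_iff.mpr hfa),
      ite_mod_eight_mul (f a) _ hfa (prod_mod_two_eq_one s f hodd')]

/-- **`D₋₂ = D₂ + D₋₁`** entrywise: `[(−2/p) = −1] = [(2/p) = −1] + [(−1/p) = −1]` for an odd prime `p`,
and `[(−1/p) = −1] = [p ≡ 3 (mod 4)]`. [cite: IrelandRosen1990, Ch. 5 §1 Prop. 5.1.2 (multiplicativity) and Prop. 5.1.3] -/
theorem addLegendreSym_neg_two_eq {b : ℕ} (hb : Odd b) :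
    addLegendreSym (-2) b = addLegendreSym 2 b + if b % 4 = 3 then 1 else 0 := by
  have hb8 : b % 8 = 1 ∨ b % 8 = 3 ∨ b % 8 = 5 ∨ b % 8 = 7 := by rcases hb with ⟨m, rfl⟩; omega
  rw [addLegendreSym_two_eq hb]
  rcases hb8 with h | h | h | h
  · rw [if_neg (by omega), if_neg (by omega), add_zero]
    exact addLegendreSym_of_eq_one (jacobiSym_neg_two_eq_one (Or.inl h))
  · rw [if_pos (Or.inl h), if_pos (by omega)]
    exact (addLegendreSym_of_eq_one (jacobiSym_neg_two_eq_one (Or.inr h))).trans (by decide)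
  · rw [if_pos (Or.inr h), if_neg (by omega), add_zero]
    exact addLegendreSym_of_eq_neg_one (jacobiSym_neg_two_eq_neg_one (Or.inl h))
  · rw [if_neg (by omega), if_pos (by omega), zero_add]
    exact addLegendreSym_of_eq_neg_one (jacobiSym_neg_two_eq_neg_one (Or.inr h))

/-! ### §2. Feng–Xiong Thm. 2.4 through Monsky's matrix (odd `n ≡ 3 (mod 8)`, `p₀ ≡ 3 (mod 4)`) -/

section Odd

variable (p : Fin (k + 1) → ℕ)

/-- Coordinate sum of `D₂ v`: `Σᵢ [(2/pᵢ) = −1] vᵢ`. [cite: HeathBrown1994SelmerCongruentII, Appendix (Monsky), typescript p. 39 L10–L13 (the diagonal matrices D_j)] -/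
theorem legendreDiagonal_mulVec_apply (a : ℤ) (v : Fin (k + 1) → ZMod 2) (i : Fin (k + 1)) :
    (legendreDiagonal p a *ᵥ v) i = addLegendreSym a (p i) * v i := by
  rw [legendreDiagonal, Matrix.mulVec_diagonal]

/-- In case FX-2.4, `D₋₂ = D₂ + E₀₀`. [cite: IrelandRosen1990, Ch. 5 §1 Props. 5.1.2–5.1.3] -/
theorem legendreDiagonal_neg_two_eq_add (h3 : p 0 % 4 = 3) (h1 : ∀ i, i ≠ 0 → p i % 4 = 1) :
    legendreDiagonal p (-2) =
      legendreDiagonal p 2 + Matrix.diagonal fun j : Fin (k + 1) => if j = 0 then (1 : ZMod 2) else 0 := by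
  rw [legendreDiagonal, legendreDiagonal, Matrix.diagonal_add]
  congr 1
  funext j
  have hodd : Odd (p j) := by
    rcases eq_or_ne j 0 with rfl | hj
    · exact Nat.odd_iff.mpr (by omega)
    · have := h1 j hj; exact Nat.odd_iff.mpr (by omega)
  rw [addLegendreSym_neg_two_eq hodd]
  rcases eq_or_ne j 0 with rfl | hj
  · rw [if_pos h3, if_pos rfl]
  · rw [if_neg (by have := h1 j hj; omega), if_neg hj]

/-- In case FX-2.4 the diagonal of `D₂` sums to `1`: `n ≡ 3 (mod 8)` has an odd number of prime factors
`≡ ±3 (mod 8)`. [cite: IrelandRosen1990, Ch. 5 §2 Prop. 5.2.2] -/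
theorem sum_addLegendreSym_two_eq_one (hodd : ∀ i, Odd (p i)) (h8 : (∏ i, p i) % 8 = 3) :
    ∑ i, addLegendreSym 2 (p i) = 1 := by
  rw [sum_addLegendreSym_two_eq Finset.univ p fun i _ => Nat.odd_iff.mp (hodd i), if_pos (Or.inl h8)]

/-- **Feng–Xiong Thm. 2.4 (Rhoades Thm. 2.3) through Monsky's matrix**: `det M = 1` (so `s(n) = 0`) for
`n = p₀p₁⋯p_k ≡ 3 (mod 8)` with `p₀ ≡ 3 (mod 4)`, `pᵢ ≡ 1 (mod 4)` (`i ≥ 1`) and `G(n)` odd (kernel of `A`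
= `{0, 1}`), uniformly in `k`. [cite: Rhoades2009, Thm. 2.3 (= Feng–Xiong 2004 Thm. 2.4; arXiv:0706.4344 chunk p0006 L61–L71)] [cite: HeathBrown1994SelmerCongruentII, Appendix (Monsky), typescript p. 39 L27–L33 (the matrix; evaluation ours)] -/
theorem det_monskyMatrixOdd_eq_one_of_oddGraph_three_mod_four (h3 : p 0 % 4 = 3)
    (h1 : ∀ i, i ≠ 0 → p i % 4 = 1) (h8 : (∏ i, p i) % 8 = 3)
    (hG : ∀ v, legendreMatrix p *ᵥ v = 0 → v = 0 ∨ v = fun _ => 1) :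
    (monskyMatrixOdd p).det = 1 := by
  classical
  have hodd : ∀ i, Odd (p i) := by
    intro i
    rcases eq_or_ne i 0 with rfl | hi
    · exact Nat.odd_iff.mpr (by omega)
    · have := h1 i hi; exact Nat.odd_iff.mpr (by omega)
  have hsymm := legendreMatrix_transpose_eq p hodd h1
  set A := legendreMatrix p with hA
  set D := legendreDiagonal p 2 with hD
  set E : Matrix (Fin (k + 1)) (Fin (k + 1)) (ZMod 2) :=
    Matrix.diagonal fun j : Fin (k + 1) => if j = 0 then (1 : ZMod 2) else 0 with hE
  have hDm2 : legendreDiagonal p (-2) = D + E := legendreDiagonal_neg_two_eq_add p h3 h1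
  -- coordinate sums
  have hsumA : ∀ v, ∑ i, (A *ᵥ v) i = 0 := sum_legendreMatrix_mulVec_eq_zero p hsymm
  have hsumD : ∀ v : Fin (k + 1) → ZMod 2, ∑ i, (D *ᵥ v) i = ∑ i, addLegendreSym 2 (p i) * v i :=
    fun v => Finset.sum_congr rfl fun i _ => legendreDiagonal_mulVec_apply p 2 v i
  have hE0 : ∀ v : Fin (k + 1) → ZMod 2, E *ᵥ v = fun j => if j = 0 then v 0 else 0 := by
    intro v; funext j
    rw [hE, Matrix.mulVec_diagonal]
    split_ifs with hj
    · rw [hj, one_mul]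
    · rw [zero_mul]
  have hsumE : ∀ v : Fin (k + 1) → ZMod 2, ∑ i, (E *ᵥ v) i = v 0 := by
    intro v; rw [hE0, Finset.sum_ite_eq' Finset.univ (0 : Fin (k + 1)) (fun _ => v 0), if_pos (Finset.mem_univ _)]
  have hD1 : ∑ i, (D *ᵥ fun _ => (1 : ZMod 2)) i = 1 := by
    rw [hsumD]; simp_rw [mul_one]; exact sum_addLegendreSym_two_eq_one p hodd h8
  apply det_eq_one_of_ker_trivial
  intro z hz
  obtain ⟨x, y, rfl⟩ : ∃ x y, z = Sum.elim x y := ⟨z ∘ Sum.inl, z ∘ Sum.inr, (Sum.elim_comp_inl_inr z).symm⟩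
  rw [monskyMatrixOdd, ← hA, ← hD, hDm2, Matrix.fromBlocks_mulVec] at hz
  simp only [Sum.elim_comp_inl, Sum.elim_comp_inr] at hz
  have htop : A *ᵥ x + D *ᵥ x + D *ᵥ y = 0 := by
    funext i; have := congr_fun hz (Sum.inl i)
    simpa only [Sum.elim_inl, Pi.zero_apply, Matrix.add_mulVec] using this
  have hbot : D *ᵥ x + (A *ᵥ y + D *ᵥ y + E *ᵥ y) = 0 := by
    funext i; have := congr_fun hz (Sum.inr i)
    simpa only [Sum.elim_inr, Pi.zero_apply, Matrix.add_mulVec, add_assoc] using this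
  -- (a) summing the top row: Σ dᵢ (xᵢ + yᵢ) = 0; (b) summing the bottom row: … + y₀ = 0 ⇒ y₀ = 0
  have hsum_top : ∑ i, (D *ᵥ x) i + ∑ i, (D *ᵥ y) i = 0 := by
    have := congr_arg (fun v : Fin (k + 1) → ZMod 2 => ∑ i, v i) htop
    simpa only [Pi.add_apply, Finset.sum_add_distrib, hsumA, zero_add, Pi.zero_apply,
      Finset.sum_const_zero] using this
  have hy0 : y 0 = 0 := by
    have := congr_arg (fun v : Fin (k + 1) → ZMod 2 => ∑ i, v i) hbot
    simp only [Pi.add_apply, Finset.sum_add_distrib, hsumA, zero_add, Pi.zero_apply,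
      Finset.sum_const_zero, hsumE] at this
    -- this : Σ(Dx) + (Σ(Dy) + y₀) = 0
    have h' : ∑ i, (D *ᵥ x) i + ∑ i, (D *ᵥ y) i + y 0 = 0 := by rw [add_assoc]; exact this
    rwa [hsum_top, zero_add] at h'
  have hEy : E *ᵥ y = 0 := by rw [hE0, hy0]; funext j; split_ifs <;> rfl
  have h2 : ∀ u : Fin (k + 1) → ZMod 2, u + u = 0 := fun u => by
    funext i; exact CharTwo.add_self_eq_zero _
  -- (c) the two block rows give `A x = D x + D y = A y`, hence `A (x + y) = 0`
  have e1 : A *ᵥ x = D *ᵥ x + D *ᵥ y := by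
    rw [add_assoc] at htop
    rw [eq_neg_of_add_eq_zero_left htop, neg_eq_self_pi]
  have e2 : A *ᵥ y = D *ᵥ x + D *ᵥ y := by
    rw [hEy, add_zero] at hbot
    have h' : A *ᵥ y + D *ᵥ y = D *ᵥ x := by
      rw [eq_neg_of_add_eq_zero_right hbot, neg_eq_self_pi]
    calc A *ᵥ y = A *ᵥ y + D *ᵥ y + D *ᵥ y := by rw [add_assoc, h2, add_zero]
      _ = D *ᵥ x + D *ᵥ y := by rw [h']
  have hAxy : A *ᵥ (x + y) = 0 := by rw [Matrix.mulVec_add, e1, e2, h2]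
  rcases hG (x + y) hAxy with hxy | hxy
  · -- `y = x`: then `A x = 0`, `x ∈ {0, 1}`, and `x₀ = y₀ = 0` forces `x = 0`
    have hyx : y = x := by rw [eq_neg_of_add_eq_zero_right hxy, neg_eq_self_pi]
    rw [hyx] at e1 hy0
    rw [h2] at e1
    have hx : x = 0 := eq_zero_of_mulVec_eq_zero p hG e1 hy0
    rw [hyx, hx]
    funext i; cases i <;> rfl
  · -- `y = x + 1`: then `A x = D·1`, impossible (coordinate sums `0 ≠ 1`)
    exfalso
    have hy : y = x + fun _ => 1 := by
      rw [← hxy]; funext i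
      simp only [Pi.add_apply]
      rw [← add_assoc, CharTwo.add_self_eq_zero, zero_add]
    have hAx1 : A *ᵥ x = D *ᵥ fun _ => (1 : ZMod 2) := by
      rw [e1, hy, Matrix.mulVec_add, ← add_assoc, h2, zero_add]
    have hsum : ∑ i, (A *ᵥ x) i = ∑ i, (D *ᵥ fun _ => (1 : ZMod 2)) i := by rw [hAx1]
    rw [hsumA, hD1] at hsum
    exact zero_ne_one hsum

/-- Rank form of the hypothesis (Feng's Lemma 2.2: "`G` odd iff `rank M(G) = t − 1`").
[cite: Rhoades2009, Lemma 2.6 (= Feng–Xiong Lemma 2.2; arXiv:0706.4344 chunk p0006 L143–L147)] -/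
theorem det_monskyMatrixOdd_eq_one_of_rank_eq_three_mod_four (h3 : p 0 % 4 = 3)
    (h1 : ∀ i, i ≠ 0 → p i % 4 = 1) (h8 : (∏ i, p i) % 8 = 3) (hr : (legendreMatrix p).rank = k) :
    (monskyMatrixOdd p).det = 1 :=
  det_monskyMatrixOdd_eq_one_of_oddGraph_three_mod_four p h3 h1 h8 (eq_zero_or_eq_one_of_rank_eq p hr)

/-- **`BSD(E_n, ℓ)` for every prime `ℓ` on the Feng–Xiong family 2.4** (`n = p₀⋯p_k ≡ 3 (mod 8)`,
`p₀ ≡ 3 (mod 4)`, `pᵢ ≡ 1 (mod 4)`, `G(n)` odd), modulo Monsky's theorem and the journal facts BT26 /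
Deuring–Hecke / BF24 (§6 of the main file). [cite: Rhoades2009, Thm. 2.3 (= Feng–Xiong 2004 Thm. 2.4)] [cite: BurungaleTian2026, Thm. 1.1 with Cor. 1.4] [cite: BurungaleFlach2024, Cor. 2] -/
theorem forall_bsdp_of_oddGraph_three_mod_four (hM : monsky_card_selmerGroup_two_odd)
    (hBT : burungaleTian_analyticRank_eq_zero_of_selmerCorank_eq_zero_of_hasCM)
    (hH : hasEntireLFunction_of_j_mem_maximalCMJInvariants)
    (hBF : bsdTriple_of_hasCM_of_L_one_ne_zero) (hp : ∀ i, (p i).Prime) (hinj : Function.Injective p)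
    (h3 : p 0 % 4 = 3) (h1 : ∀ i, i ≠ 0 → p i % 4 = 1) (h8 : (∏ i, p i) % 8 = 3)
    (hG : ∀ v, legendreMatrix p *ᵥ v = 0 → v = 0 ∨ v = fun _ => 1) (ℓ : ℕ) (hℓ : ℓ.Prime) :
    haveI := isElliptic_congruentNumberCurve (n := ∏ i, p i)
      (Finset.prod_ne_zero_iff.mpr fun i _ => (hp i).ne_zero)
    haveI := isGloballyMinimal_congruentNumberCurve (n := ∏ i, p i) (squarefree_prod_of_injective p hp hinj)
    BSDp (congruentNumberCurve (∏ i, p i)) ℓ := by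
  have hodd : ∀ i, Odd (p i) := by
    intro i
    rcases eq_or_ne i 0 with rfl | hi
    · exact Nat.odd_iff.mpr (by omega)
    · have := h1 i hi; exact Nat.odd_iff.mpr (by omega)
  exact forall_bsdp_of_monsky_of_BT_BF_odd p hM hBT hH hBF hp hodd hinj
    (det_monskyMatrixOdd_eq_one_of_oddGraph_three_mod_four p h3 h1 h8 hG) ℓ hℓ

end Odd

/-! ### §3. Feng–Xiong Thm. 2.6 through Monsky's matrix (`n = 2m`, all `pᵢ ≡ 1 (mod 4)`) -/

section Even

variable (p : Fin k → ℕ)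

/-- `D₋₁ = 0` when every prime is `≡ 1 (mod 4)`. [cite: IrelandRosen1990, Ch. 5 §1 Prop. 5.1.3 ((−1/p))] -/
theorem legendreDiagonal_neg_one_eq_zero (h1 : ∀ i, p i % 4 = 1) : legendreDiagonal p (-1) = 0 := by
  unfold legendreDiagonal
  rw [← Matrix.diagonal_zero]
  congr 1
  funext j
  exact addLegendreSym_of_eq_one (jacobiSym_neg_one_eq_one (h1 j))

/-- `A` is symmetric when every prime is `≡ 1 (mod 4)`. [cite: IrelandRosen1990, Ch. 5 §2 Thm. 2 (reciprocity)] -/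
theorem legendreMatrix_transpose_eq_of_one_mod_four (h1 : ∀ i, p i % 4 = 1) :
    (legendreMatrix p)ᵀ = legendreMatrix p := by
  ext i j
  rw [Matrix.transpose_apply]
  rcases eq_or_ne i j with rfl | hij
  · rfl
  · rw [legendreMatrix_apply_of_ne p hij, legendreMatrix_apply_of_ne p hij.symm]
    exact addLegendreSym_comm_of_mod_four_eq_one (h1 i) (Nat.odd_iff.mpr (by have := h1 j; omega))

/-- **Feng–Xiong Thm. 2.6 (Rhoades Thm. 2.4) through Monsky's matrix**: for `n = 2p₀⋯p_{k−1}` with every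
`pᵢ ≡ 1 (mod 4)`, if `G′(n/2)` is odd — in kernel form: `(A + D₂) v = 0 ⟹ v = 0` — then `det M = 1`
(so `s(n) = 0`), uniformly in `k`: `D₋₁ = 0` and `Aᵀ = A` make `M = (A + D₂, 0; D₂, A + D₂)` block
triangular. [cite: Rhoades2009, Thm. 2.4 (= Feng–Xiong 2004 Thm. 2.6; arXiv:0706.4344 chunk p0006 L73–L78)] [cite: HeathBrown1994SelmerCongruentII, Appendix (Monsky), typescript p. 41 L20–L36 (the even matrix; evaluation ours)] -/
theorem det_monskyMatrixEven_eq_one_of_oddGraph_two (h1 : ∀ i, p i % 4 = 1)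
    (hG' : ∀ v, (legendreMatrix p + legendreDiagonal p 2) *ᵥ v = 0 → v = 0) :
    (monskyMatrixEven p).det = 1 := by
  have hsymm := legendreMatrix_transpose_eq_of_one_mod_four p h1
  have hDm1 := legendreDiagonal_neg_one_eq_zero p h1
  apply det_eq_one_of_ker_trivial
  intro z hz
  obtain ⟨x, y, rfl⟩ : ∃ x y, z = Sum.elim x y := ⟨z ∘ Sum.inl, z ∘ Sum.inr, (Sum.elim_comp_inl_inr z).symm⟩
  rw [monskyMatrixEven, hsymm, hDm1, Matrix.fromBlocks_mulVec] at hz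
  simp only [Sum.elim_comp_inl, Sum.elim_comp_inr, Matrix.zero_mulVec, add_zero] at hz
  have htop : (legendreMatrix p + legendreDiagonal p 2) *ᵥ x = 0 := by
    funext i; have := congr_fun hz (Sum.inl i); simpa only [Sum.elim_inl, Pi.zero_apply] using this
  have hx : x = 0 := hG' x htop
  subst hx
  have hbot : (legendreMatrix p + legendreDiagonal p 2) *ᵥ y = 0 := by
    funext i; have := congr_fun hz (Sum.inr i)
    simpa only [Sum.elim_inr, Pi.zero_apply, Matrix.mulVec_zero, zero_add] using this
  have hy : y = 0 := hG' y hbot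
  subst hy
  funext i; cases i <;> rfl

/-- Determinant form of the hypothesis: `det(A + D₂) = 1` (⟺ `G′(n/2)` odd, by Feng–Xiong Lemma 2.2 applied to
`L(G′)`, whose row at the vertex `2` is zero). [cite: Rhoades2009, Lemma 2.6 (= Feng–Xiong Lemma 2.2)] -/
theorem det_monskyMatrixEven_eq_one_of_det_eq_one (h1 : ∀ i, p i % 4 = 1)
    (hdet : (legendreMatrix p + legendreDiagonal p 2).det = 1) : (monskyMatrixEven p).det = 1 := by
  refine det_monskyMatrixEven_eq_one_of_oddGraph_two p h1 fun v hv => ?_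
  have hU : IsUnit (legendreMatrix p + legendreDiagonal p 2) :=
    (Matrix.isUnit_iff_isUnit_det _).mpr (by rw [hdet]; exact isUnit_one)
  exact Matrix.mulVec_injective_iff_isUnit.mpr hU (by rw [hv, Matrix.mulVec_zero])

/-- **`BSD(E_n, ℓ)` for every prime `ℓ` on the Feng–Xiong family 2.6** (`n = 2p₀⋯p_{k−1}`, all
`pᵢ ≡ 1 (mod 4)`, `G′(n/2)` odd in kernel form), modulo Monsky's theorem (even case) and the journal facts
BT26 / Deuring–Hecke / BF24 (§6 of the main file). [cite: Rhoades2009, Thm. 2.4 (= Feng–Xiong 2004 Thm. 2.6)] [cite: BurungaleTian2026, Thm. 1.1 with Cor. 1.4] [cite: BurungaleFlach2024, Cor. 2] -/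
theorem forall_bsdp_of_oddGraph_two (hM : monsky_card_selmerGroup_two_even)
    (hBT : burungaleTian_analyticRank_eq_zero_of_selmerCorank_eq_zero_of_hasCM)
    (hH : hasEntireLFunction_of_j_mem_maximalCMJInvariants)
    (hBF : bsdTriple_of_hasCM_of_L_one_ne_zero) (hp : ∀ i, (p i).Prime) (hinj : Function.Injective p)
    (h1 : ∀ i, p i % 4 = 1) (hG' : ∀ v, (legendreMatrix p + legendreDiagonal p 2) *ᵥ v = 0 → v = 0)
    (ℓ : ℕ) (hℓ : ℓ.Prime) :
    haveI := isElliptic_congruentNumberCurve (n := 2 * ∏ i, p i)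
      (mul_ne_zero two_ne_zero (Finset.prod_ne_zero_iff.mpr fun i _ => (hp i).ne_zero))
    haveI := isGloballyMinimal_congruentNumberCurve (n := 2 * ∏ i, p i)
      (squarefree_two_mul_prod_of_injective p hp (fun i => Nat.odd_iff.mpr (by have := h1 i; omega)) hinj)
    BSDp (congruentNumberCurve (2 * ∏ i, p i)) ℓ :=
  forall_bsdp_of_monsky_of_BT_BF_even p hM hBT hH hBF hp (fun i => Nat.odd_iff.mpr (by have := h1 i; omega))
    hinj (det_monskyMatrixEven_eq_one_of_oddGraph_two p h1 hG') ℓ hℓ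

end Even

end Literature.NumberTheory.EllipticCurves.HeathBrown1994.Families
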